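import Summits.Langlands.Langlands.Theses.OrdinaryPrimeTransport
import Literature.NumberTheory.EllipticCurves.FramedTateGaloisRep
import Literature.NumberTheory.Automorphic.CaraianiNewtonResidualImageModularity
import Literature.NumberTheory.Automorphic.CaraianiNewtonResidualImageModularityProofs
import Literature.NumberTheory.Automorphic.ReciprocityGLnPotentialModularityTateProofs
import Literature.NumberTheory.Automorphic.GLnAdelicStructureProofs
import HarnessLib

/-!
# SKELETON — line `QuarticCMEllipticGaloisToAutomorphic` for the crux `ReciprocityUpToIrreducibility`
# (item stmt-Langlands-14328; routes IrreducibilityBySelfDuality / OrdinaryPrimeTransport)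
# forward generator G4 ladder-down, generation 15 (unit fwd2-ladder-Langlands-14328-g15)

Dial θ18 = the DEGREE `d = [K:ℚ]` of the imaginary CM base field in Caraiani–Newton's residual-image
modularity theorem, inside clause (B) of the top E = `ReciprocityUpToIrreducibility` at `n = 2`.
Floor `d = 2` = Caraiani–Newton 2023 Cor. 6.1.1 (in-tree named fact `CaraianiNewton2023_cor611_nonCM_printed`,
`floor_two`); THE RUNG `d = 4` (imaginary CM QUARTIC fields `K ≠ ℚ(ζ₅)`) is DERIVED from two stubs exactly as
the source derives Cor. 6.1.1 ("Combine Theorem 6.1 and Lemma 6.2.2", p. 87) one degree up: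
`rung_of_thm61_of_lemma622Quartic : CaraianiNewtonThm61 → Lemma622QuarticCM → QuarticCMEllipticGaloisToAutomorphic`.

Six registered stubs; the kernel-checked composition `ReciprocityUpToIrreducibility_of : <stub₁-sig> → … → <stub₆-sig> → E`
and `reciprocityUpToIrreducibility_of_stubs` (the composition applied to the six `stub_*`).  TREE COPY: this file concludes
route OrdinaryPrimeTransport's decl `Summit.Langlands.Langlands.Theses.OrdinaryPrimeTransport.ReciprocityUpToIrreducibility`
(the shared item stmt-Langlands-14328; the IrreducibilityBySelfDuality decl is the same text verbatim — the REGISTERED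
skeleton (seat folder, `ledger skeleton check`, theorem `reciprocityUpToIrreducibility_of_stubs`) concludes that one BY NAME;
the IrreducibilityBySelfDuality Theses module does not elaborate on the crux-write host, as for g3–g14):

* `stub_thm61 : CaraianiNewtonThm61` — Caraiani–Newton Thm. 6.1 verbatim in the tree's rendering (every imaginary CM
  `K ∌ ζ₅`, curve non-CM, `r̄_{E,p}` DECOMPOSED GENERIC and absolutely irreducible over `K(ζ_p)`, `p ∈ {3,5}`):
  a theorem IN PRINT without carrier (XL apex: Thm. 5.2 + [AKT23] + solvable descent);
* `stub_lemma622QuarticGalois : Lemma622QuarticCMGalois` and `stub_lemma622QuarticNonGalois : Lemma622QuarticCMNonGalois`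
  — Lemma 6.2.2 ONE DEGREE UP, for exactly what the rung consumes (the `p`-torsion, `p ∈ {3,5}`, of a non-CM elliptic
  curve over an imaginary CM QUARTIC field, absolutely irreducible over `K(ζ_p)`, is decomposed generic), split by
  whether `K/ℚ` is Galois: case A is a four-coordinate version of the tree's PROVED quadratic lemma
  (`isDecomposedGeneric_of_isAbsolutelyIrreducible_restrictField_cyclotomic`) — plausibly provable now; case B
  (dihedral closure) is THE OPEN CORE, with its risky locus named in the docstring (`lemma622Quartic_of_cases` glues);
* `stub_higherDegrees : HigherDegrees` — the cells `d ≥ 6` (open; the rest of the graded family);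
* `stub_sectorMerge : (∀ d, family d) → SectorGaloisToAutomorphic` — upgrade a.e.-Satake automorphy on the
  Caraiani–Newton sector to clause (B) of E verbatim (cuspidal, L-algebraic, `Corresponds` at every place, every `Rec`);
* `stub_offSector : OffSectorReciprocity` — E with clause (B) restricted OFF the sector (the honest complement).

No floor stub: the floor fact (Cor. 6.1.1, behind `floor_two`) is `floorFact_of_thm61` = Thm. 6.1 + the tree's proved quadratic
Lemma 6.2.2 (`CaraianiNewton2023_cor611_nonCM_printed_of_thm61`), so the line's own ladder is "Lemma 6.2.2 at d = 2:
theorem of the tree; at d = 4: the two stubs".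
Composition: `Rec` and clause (A) from `stub_offSector`; clause (B) by `by_cases InCNSector F ℓ ρ`.
Sorries ONLY inside the six `stub_*`.  Also recorded (sorry-free): `family_of` (all degrees from floor + rung +
higher cells; odd degrees and `d = 0` are vacuous for CM fields), `QuarticCMEllipticGaloisToAutomorphic_of_top : E → rung`.
-/

noncomputable section

set_option linter.dupNamespace false

open scoped MatrixGroups Matrix NumberField Classical Polynomial
open Filter IsDedekindDomain Field Polynomial WeierstrassCurve
open Literature.NumberTheory.Automorphic Literature.NumberTheory.GaloisRepresentations
open Literature.NumberTheory.EllipticCurves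
open Literature.NumberTheory.PAdicHodge
open Summit.Langlands

namespace Summit.Langlands.Langlands.Cruxes.ReciprocityUpToIrreducibility.QuarticCMEllipticGaloisToAutomorphic

/-! ## 1. The family, the rung -/

/-- **The RUNG FAMILY, dial = degree `d` of the imaginary CM base field** (verbatim as in
`QuarticCMEllipticGaloisToAutomorphic_onpath` / `_special`): clause (B) of the summit at `n = 2`, Galois-side and
archimedean-free, for the framed dual Tate modules `ρ_{E,ℓ}^∨` of NON-CM elliptic curves over imaginary CM fields
`K` of degree `d` with `ζ₅ ∉ K` whose mod-3 (resp. mod-5) representation is absolutely irreducible over `K(ζ₃)`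
(resp. `K(ζ₅)`), granted `ρ_{E,ℓ}^∨` irreducible and de Rham above `ℓ` for the pinned Fontaine datum. -/
def EllipticGaloisToAutomorphicCM (d : ℕ) : Prop :=
  ∀ (K : Type) [Field K] [NumberField K], NumberField.IsCMField K → Module.finrank ℚ K = d →
    (∀ x : K, x ^ 5 = 1 → x = 1) →
    ∀ (E : WeierstrassCurve K) [E.IsElliptic], ¬ E.HasCM →
      (ModPImageAbsIrreducibleOverCyclotomic E 3 ∨
        @ModPImageAbsIrreducibleOverCyclotomic K _ E 5 ⟨Nat.prime_five⟩) →
      ∀ (ℓ : ℕ) [Fact ℓ.Prime] (ι : PadicAlgCl ℓ ≃+* ℂ),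
        (E.framedTateGaloisRepDual ℓ).toGaloisRep.IsIrreducible →
        (∀ (v : HeightOneSpectrum (𝓞 K)) (hv : ((ℓ : ℕ) : 𝓞 K) ∈ v.asIdeal),
            (fontainePstAdicCompletion v ℓ hv).IsDeRhamFramed ((E.framedTateGaloisRepDual ℓ).toLocal v)) →
        ∃ (hK : isCompact_glFiniteIntegralLevel 2 K) (π : CuspidalAutomorphicRepData 2 K hK) (m : ℕ),
          ∀ᶠ v : HeightOneSpectrum (𝓞 K) in Filter.cofinite, ∃ α : Multiset ℂ,
            π.1.HasSatakeParamAt v α ∧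
            (E.framedTateGaloisRepDual ℓ).IsUnramifiedAt v ∧
            (E.framedTateGaloisRepDual ℓ).HasFrobCharpolyAt v (arithFrobPolyOfSatake ι v.residueCard m α)

/-- **THE RUNG** `d = 4`: imaginary CM QUARTIC base fields `K ≠ ℚ(ζ₅)`. -/
def QuarticCMEllipticGaloisToAutomorphic : Prop := EllipticGaloisToAutomorphicCM 4

/-! ## 2. The bridge and the floor (sorry-free; see `_special` for commentary) -/

/-- Normalisation identity (generation 6's `arithFrobPolyOfSatake_two_pair`). [folklore] -/
theorem arithFrobPolyOfSatake_two_pair {ℓ : ℕ} [Fact ℓ.Prime] (ι : PadicAlgCl ℓ ≃+* ℂ) (q : ℕ)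
    (a : ℤ) (z₁ z₂ : ℂ) (hq : q ≠ 0)
    (hsum : ((Real.sqrt q : ℝ) : ℂ) * ({z₁, z₂} : Multiset ℂ).sum = (a : ℂ))
    (hprod : ((Real.sqrt q : ℝ) : ℂ) ^ 2 * ({z₁, z₂} : Multiset ℂ).prod = (q : ℂ)) :
    arithFrobPolyOfSatake ι q 2 {z₁, z₂} =
      X ^ 2 - C ((a : PadicAlgCl ℓ) / (q : PadicAlgCl ℓ)) * X + C ((q : PadicAlgCl ℓ)⁻¹) := by
  have hs : ((Real.sqrt q : ℝ) : ℂ) * z₁ + ((Real.sqrt q : ℝ) : ℂ) * z₂ = a := by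
    simpa [Multiset.insert_eq_cons, mul_add] using hsum
  have hp' : ((Real.sqrt q : ℝ) : ℂ) ^ 2 * (z₁ * z₂) = q := by
    simpa [Multiset.insert_eq_cons] using hprod
  have hp : (((Real.sqrt q : ℝ) : ℂ) * z₁) * (((Real.sqrt q : ℝ) : ℂ) * z₂) = q := by
    linear_combination hp'
  have hq' : (q : ℂ) ≠ 0 := by exact_mod_cast hq
  have h1 : ((Real.sqrt q : ℝ) : ℂ) * z₁ ≠ 0 := fun h => hq' (by rw [← hp, h, zero_mul])
  have h2 : ((Real.sqrt q : ℝ) : ℂ) * z₂ ≠ 0 := fun h => hq' (by rw [← hp, h, mul_zero])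
  have hinv_sum : (((Real.sqrt q : ℝ) : ℂ) * z₁)⁻¹ + (((Real.sqrt q : ℝ) : ℂ) * z₂)⁻¹ = (a : ℂ) / q := by
    rw [inv_add_inv h1 h2, hs, hp]
  have hinv_prod : (((Real.sqrt q : ℝ) : ℂ) * z₁)⁻¹ * (((Real.sqrt q : ℝ) : ℂ) * z₂)⁻¹ = ((q : ℂ))⁻¹ := by
    rw [← mul_inv, hp]
  unfold arithFrobPolyOfSatake
  simp only [Multiset.insert_eq_cons, Multiset.map_cons, Multiset.map_singleton, Multiset.prod_cons,
    Multiset.prod_singleton, Nat.reduceSub, pow_one]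
  rw [X_sub_C_mul_X_sub_C, ← map_add ι.symm, ← map_mul ι.symm, hinv_sum, hinv_prod, map_div₀,
    map_inv₀, map_intCast, map_natCast]

/-- **THE BRIDGE**: weight-zero automorphy with Hecke polynomial `X² - a_w(E) X + q_w` at every good place (the
conclusion shape of the Caraiani–Newton facts) gives the family's conclusion for `ρ_{E,ℓ}^∨` with `m = 2`. [folklore] -/
theorem of_weightZeroHecke {K : Type} [Field K] [NumberField K] {E : WeierstrassCurve K} [E.IsElliptic]
    (hE : ∃ (hK : isCompact_glFiniteIntegralLevel 2 K) (π : CuspidalAutomorphicRepData 2 K hK),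
      π.1.HasWeightZero ∧
        ∀ w : HeightOneSpectrum (𝓞 K), E.HasGoodReductionAt w →
          π.1.HasHeckePolynomialAt w
            ((frobPoly (E.frobeniusTraceAt w) w.residueCard).map (Int.castRingHom ℂ)))
    (ℓ : ℕ) [Fact ℓ.Prime] (ι : PadicAlgCl ℓ ≃+* ℂ) :
    ∃ (hK : isCompact_glFiniteIntegralLevel 2 K) (π : CuspidalAutomorphicRepData 2 K hK) (m : ℕ),
      ∀ᶠ v : HeightOneSpectrum (𝓞 K) in Filter.cofinite, ∃ α : Multiset ℂ,
        π.1.HasSatakeParamAt v α ∧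
        (E.framedTateGaloisRepDual ℓ).IsUnramifiedAt v ∧
        (E.framedTateGaloisRepDual ℓ).HasFrobCharpolyAt v (arithFrobPolyOfSatake ι v.residueCard m α) := by
  obtain ⟨hK, π, -, hH⟩ := hE
  refine ⟨hK, π, 2, ?_⟩
  have hc : Continuous fun x : Field.absoluteGaloisGroup K × E.rationalTateModule ℓ =>
      Literature.NumberTheory.EllipticCurves.rationalTateRepresentation (Field.absoluteGaloisGroup K)
        (WeierstrassCurve.geomPoints E) ℓ x.1 x.2 :=
    E.continuous_rationalGaloisRepTate_holds ℓ
  haveI hfin : Module.Finite ℚ_[ℓ] (E.rationalTateModule ℓ) := E.module_finite_rationalTateModule_holds ℓ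
  filter_upwards [E.eventually_hasGoodReductionAt,
    eventually_natCast_not_mem_asIdeal K (Fact.out : ℓ.Prime).ne_zero] with v hgood hvℓ
  obtain ⟨α, hα, hsum, hprod⟩ := exists_hasSatakeParamAt_of_hasHeckePolynomialAt_frobPoly (hH v hgood)
  have hF := hasFrobCharpolyAt_rationalTateGaloisRepOf_of_hasGoodReductionAt
    (E.trace_galoisRepTate_frobenius_of_hasGoodReductionAt_holds ℓ)
    (E.det_galoisRepTate_frobenius_of_hasGoodReductionAt_holds ℓ) hc hvℓ hgood
  rw [natCard_residueField_eq_residueCard] at hF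
  have hD := E.hasFrobCharpolyAt_framedTateGaloisRepDual ℓ hc hF
  simp only [map_intCast, map_natCast] at hD
  refine ⟨α, hα, E.isUnramifiedAt_framedTateGaloisRepDual ℓ hgood hvℓ, ?_⟩
  obtain ⟨z₁, z₂, rfl⟩ := Multiset.card_eq_two.1 hα.card_eq
  rw [arithFrobPolyOfSatake_two_pair ι v.residueCard (E.frobeniusTraceAt v) z₁ z₂
    (by have := v.one_lt_residueCard; omega) hsum hprod]
  exact hD

/-- **Floor `d = 2`** from the named fact (Caraiani–Newton 2023, Cor. 6.1.1). [cite: CaraianiNewton2023, Cor. 6.1.1] -/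
theorem floor_two (h : CaraianiNewton2023_cor611_nonCM_printed) : EllipticGaloisToAutomorphicCM 2 := by
  intro K _ _ hCM hd _h5 E _ hnCM himg ℓ _ ι _ _
  haveI := hCM
  exact of_weightZeroHecke (h K (NumberField.IsCMField.isTotallyComplex K) hd E hnCM himg) ℓ ι

/-! ## 3. The two texts that give the rung: Thm. 6.1 (in print) and Lemma 6.2.2 one degree up (open) -/

/-- **Caraiani–Newton 2023, Theorem 6.1, in the tree's rendering** (literally hypothesis (A) of the tree's
architecture theorem `CaraianiNewton2023_cor611_nonCM_printed_of_thm61_of_lemma622`): for EVERY imaginary CM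
number field `F` with `ζ₅ ∉ F`, every elliptic `E / F` without CM, `p = 3` or `5`, if every framing of `E[p]` is
decomposed generic ([ACC⁺23, Def. 4.3.1], `IsDecomposedGeneric`) and `r̄_{E,p}|_{G_{F(ζ_p)}}` is absolutely
irreducible, then `E` is modular (cuspidal `π` of weight `0` with Hecke polynomial `X² - a_w X + q_w` at the good
places).  A THEOREM IN PRINT (proof: Thm. 5.2 + [AKT23] + solvable descent, p. 90) with no carrier in the tree.
[cite: CaraianiNewton2023, Thm. 6.1 p. 87] -/
def CaraianiNewtonThm61 : Prop :=
  ∀ (F : Type) [Field F] [NumberField F], NumberField.IsCMField F →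
    (∀ x : F, x ^ 5 = 1 → x = 1) → ∀ (E : WeierstrassCurve F) [E.IsElliptic], ¬ E.HasCM →
      ∀ (p : ℕ) [Fact p.Prime], (p = 3 ∨ p = 5) →
        (∀ ρ : ModPGaloisRep F (ZMod p) 2, E.IsTorsionGaloisRep p ρ →
          IsDecomposedGeneric (ρ : absoluteGaloisGroup F →* GL (Fin 2) (ZMod p))) →
        ModPImageAbsIrreducibleOverCyclotomic E p →
          ∃ (hF : isCompact_glFiniteIntegralLevel 2 F) (π : CuspidalAutomorphicRepData 2 F hF),
            π.1.HasWeightZero ∧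
              ∀ w : HeightOneSpectrum (𝓞 F), E.HasGoodReductionAt w →
                π.1.HasHeckePolynomialAt w
                  ((frobPoly (E.frobeniusTraceAt w) w.residueCard).map (Int.castRingHom ℂ))

/-- **Lemma 6.2.2 ONE DEGREE UP, in the form the rung consumes — the open core of the rung.**  Printed (p. 90, for
`[F:ℚ] = 2`, every odd `p` and every `ρ̄`; PROVED in the tree as `CaraianiNewton2023_lemma622`): *"Suppose that
`ρ̄|_{G_{F(ζ_p)}}` is absolutely irreducible. Then `ρ̄` is decomposed generic."*  Here, EXACTLY what Thm. 6.1 needs for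
the rung and nothing more: `F` imaginary CM QUARTIC, `E / F` without CM satisfying (1) ∨ (2); then FOR SOME `p ∈ {3,5}`
BOTH `r̄_{E,p}|_{G_{F(ζ_p)}}` is absolutely irreducible AND every model `ρ` of `E[p]` is decomposed generic ([ACC⁺23,
Def. 4.3.1] as rendered by `IsDecomposedGeneric`/`IsGenericAt`: a prime `l ≠ p` split completely in `F`, `ρ` unramified
above `l`, and at every `w ∣ l` the Frobenius eigenvalues `α_w, β_w` distinct with `α_w ≠ l·β_w`, `β_w ≠ l·α_w`; as
`α_w β_w = ε̄_p(Frob_w) = l` this reads: `α_w ≠ β_w` and `α_w, β_w ∉ {±1}`).  The `∃ p` form is deliberate (typing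
checklist 4c): a per-prime statement is refutable on loci irrelevant to the rung (see case B), whereas a counterexample
to THIS statement is a curve for which the Caraiani–Newton method fails at both primes — the genuine obstruction.
WHY OPEN: for `τ` a Frobenius at a prime split completely in `F` the four places `w ∣ l` see the four CONJUGATES
`r̄^{σ_i}(τ) = r̄(σ_i τ σ_i⁻¹)` (`σ_i` coset representatives of `Γ_F` in `Γ_ℚ`, `τ` in the normal subgroup `Γ_{F̃}`,
`F̃` the Galois closure), so one needs an element of the joint image in `r̄(Γ_{F̃})⁴` generic in every coordinate; the
printed proof is the two-coordinate case via Goursat.  In print beyond quadratic only for "`F/ℚ` Galois, `SL₂(𝔽₅) ⊆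
im r̄_{E,5}`" (Allen–Newton 2020, as used in Cor. 6.1.2).
[cite: CaraianiNewton2023, Lemma 6.2.2 p. 90 (quadratic case); Cor. 6.1.2 p. 87] -/
def Lemma622QuarticCM : Prop :=
  ∀ (F : Type) [Field F] [NumberField F], NumberField.IsCMField F → Module.finrank ℚ F = 4 →
    ∀ (E : WeierstrassCurve F) [E.IsElliptic], ¬ E.HasCM →
      (ModPImageAbsIrreducibleOverCyclotomic E 3 ∨ ModPImageAbsIrreducibleOverCyclotomic E 5) →
        ∃ (p : ℕ) (_ : Fact p.Prime), (p = 3 ∨ p = 5) ∧ ModPImageAbsIrreducibleOverCyclotomic E p ∧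
          ∀ ρ : ModPGaloisRep F (ZMod p) 2, E.IsTorsionGaloisRep p ρ →
            IsDecomposedGeneric (ρ : absoluteGaloisGroup F →* GL (Fin 2) (ZMod p))

/-- **Case A of the open core — `F/ℚ` GALOIS (biquadratic or cyclic quartic CM), per prime.**  Here `Γ_F ⊴ Γ_ℚ` and
`Γ_{F(ζ_p)} ⊴ Γ_ℚ`, the four Frobenius elements above a prime `l ≡ 1 (mod p)` split in `F` are `σ_i τ σ_i⁻¹` with
`τ ∈ Γ_{F(ζ_p)}`, and the printed two-coordinate argument becomes a four-coordinate COUNT: for the irreducible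
`G₁ = r̄(Γ_{F(ζ_p)}) ≤ SL₂(𝔽_p)` (`p = 3`: `Q₈`, `SL₂(𝔽₃)`; `p = 5`: `Q₈`, `Dic₃`, `2T`, `SL₂(𝔽₅)`) the joint image
`Ĝ ≤ G₁⁴` (all projections onto `G₁`) has an element regular semisimple in every coordinate — when `p ∤ |G₁|` the
non-generic elements are the centre `{±1}` and four subgroups `pr_i⁻¹(Z)` of index `|G₁/Z| ≥ 4` never cover `Ĝ`
(`|⋃| ≤ 4·|Ĝ|/4 − 3`); when `p ∣ |G₁|` (`SL₂(𝔽₃)`, `SL₂(𝔽₅)`) run the same count in a Sylow 2-subgroup `P̂ ≤ Q₈⁴` of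
`Ĝ` (its projections are Sylow, = `Q₈`; order-4 elements have eigenvalues `±i`, distinct and `≠ ±1` in characteristic
3 and 5).  PLAUSIBLY PROVABLE NOW (M/L): the template is the tree's proof of the quadratic lemma
(`isDecomposedGeneric_of_isAbsolutelyIrreducible_restrictField_cyclotomic`: `absGaloisOuterConj`,
`chebotarev_artinRep_holds`, heart `CaraianiNewton.exists_disc_ne_zero_and_disc_apply_ne_zero` with ONE outer
endomorphism `θ`; here three, and a counting lemma replaces Goursat).
[cite: CaraianiNewton2023, Lemma 6.2.2 p. 90 (template)] -/
def Lemma622QuarticCMGalois : Prop :=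
  ∀ (F : Type) [Field F] [NumberField F], NumberField.IsCMField F → Module.finrank ℚ F = 4 → IsGalois ℚ F →
    ∀ (E : WeierstrassCurve F) [E.IsElliptic], ¬ E.HasCM → ∀ (p : ℕ) [Fact p.Prime], (p = 3 ∨ p = 5) →
      ModPImageAbsIrreducibleOverCyclotomic E p →
        ∀ ρ : ModPGaloisRep F (ZMod p) 2, E.IsTorsionGaloisRep p ρ →
          IsDecomposedGeneric (ρ : absoluteGaloisGroup F →* GL (Fin 2) (ZMod p))

/-- **Case B of the open core — `F/ℚ` NOT Galois (closure `F̃ = F(√n)`, `n = N_{F⁺/ℚ}(α) ∈ ℚ_{>0}` for `F = F⁺(√-α)`,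
group `D₄`), in the `∃ p` form the rung consumes.**  Frobenius at a prime split completely in `F` lies in `Γ_{F̃}`
and the four places see the conjugate representations `r̄^{σ_i}|_{Γ_{F̃}}`.  Planner's analysis (to be checked by the
prover/refuter; recorded in the line card): (i) if `H₁ = r̄(Γ_{F̃(ζ_p)})` is still irreducible, case A's count applies
verbatim; (ii) `p = 3`, `H₁` reducible forces `r̄(Γ_F) = N_ns(3) ≅ SD₁₆`, `H₁ = C₄`, `r̄(Γ_{F̃}) ∈ {C₈, D₈}`: for `C₈`
every `τ ∈ Γ_{F̃} ∖ Γ_{F̃(ζ₃)}` has order-8 (generic) image in all coordinates; for `D₈` genericity on `Γ_{F̃(ζ₃)}`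
means avoiding the four `Γ_ℚ`-conjugate index-2 kernels of `χ²`, and index-2 subgroups permuted TRANSITIVELY by a
group acting on ≤ 4 of them never cover (a Scorza triple would transport to all four triples and force `χ² = 1`) — so
hypothesis (1) should GIVE decomposed genericity at 3 outright; (iii) `p = 5`, `H₁` reducible (`G₁ ∈ {Q₈, Dic₃}` in a
Cartan normaliser): anti-Cartan Frobenii are generic whenever `l ≢ −1 (mod 5)` and the transport lemma handles the
index-2 avoidances; the configurations NOT excluded by symmetry need `√5 ∈ F̃` (so that `ε̄₅|_{Γ_{F̃}}` is quadratic):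
four conjugate CUBIC characters in tetracode position (`G₁ = Dic₃`, Cartan field `F̃`), or `ε̄₅` in the span of the
conjugate Cartan characters (`G₁ = Q₈`).  A counterexample to THIS statement must defeat both primes: hypothesis (2)
with such a mod-5 configuration AND hypothesis (1) failing — the named risk locus; a refutation there is an
obstruction to the Caraiani–Newton method itself for that curve (the rung stays a consequence of the summit).
OPEN; plausibly provable off the named locus by (i)–(iii) (example field for the locus: `F = ℚ(√-(4+√5))`, `F⁺ = ℚ(√5)`, `n = 11`). [cite: CaraianiNewton2023, Lemma 6.2.2 p. 90; Cor. 6.1.2 p. 87] -/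
def Lemma622QuarticCMNonGalois : Prop :=
  ∀ (F : Type) [Field F] [NumberField F], NumberField.IsCMField F → Module.finrank ℚ F = 4 → ¬ IsGalois ℚ F →
    ∀ (E : WeierstrassCurve F) [E.IsElliptic], ¬ E.HasCM →
      (ModPImageAbsIrreducibleOverCyclotomic E 3 ∨ ModPImageAbsIrreducibleOverCyclotomic E 5) →
        ∃ (p : ℕ) (_ : Fact p.Prime), (p = 3 ∨ p = 5) ∧ ModPImageAbsIrreducibleOverCyclotomic E p ∧
          ∀ ρ : ModPGaloisRep F (ZMod p) 2, E.IsTorsionGaloisRep p ρ →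
            IsDecomposedGeneric (ρ : absoluteGaloisGroup F →* GL (Fin 2) (ZMod p))

/-- The open core from its two cases (sorry-free glue; case A is per prime, so either hypothesis picks its prime). [folklore] -/
theorem lemma622Quartic_of_cases (hG : Lemma622QuarticCMGalois) (hN : Lemma622QuarticCMNonGalois) :
    Lemma622QuarticCM := by
  intro F _ _ hCM hd E _ hnCM himg
  by_cases hgal : IsGalois ℚ F
  · rcases himg with h3 | h5
    · exact ⟨3, inferInstance, Or.inl rfl, h3, fun ρ hρ => hG F hCM hd hgal E hnCM 3 (Or.inl rfl) h3 ρ hρ⟩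
    · haveI h5p : Fact (Nat.Prime 5) := ⟨Nat.prime_five⟩
      exact ⟨5, h5p, Or.inr rfl, h5, fun ρ hρ => hG F hCM hd hgal E hnCM 5 (Or.inr rfl) h5 ρ hρ⟩
  · exact hN F hCM hd hgal E hnCM himg

/-- **The floor is Thm. 6.1 away** — no separate floor debt: Cor. 6.1.1 (the named fact behind `floor_two`) follows
from `CaraianiNewtonThm61` by the tree's PROVED quadratic Lemma 6.2.2
(`Literature.NumberTheory.Automorphic.CaraianiNewton2023_lemma622` =
`isDecomposedGeneric_of_isAbsolutelyIrreducible_restrictField_cyclotomic`, file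
`GaloisRepresentations/DecomposedGenericOfQuadratic`) through `CaraianiNewton2023_cor611_nonCM_printed_of_thm61`.
So the degree ladder of THIS line reads: Lemma 6.2.2 at `d = 2` — a theorem of the tree; at `d = 4` — the stubs.
[cite: CaraianiNewton2023, Cor. 6.1.1 p. 87, Lemma 6.2.2 p. 90] -/
theorem floorFact_of_thm61 (hA : CaraianiNewtonThm61) : CaraianiNewton2023_cor611_nonCM_printed :=
  CaraianiNewton2023_cor611_nonCM_printed_of_thm61 hA

/-- **THE RUNG FROM THE TWO TEXTS** — "Combine Theorem 6.1 and Lemma 6.2.2" one degree up, then the bridge.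
(Sorry-free.) [cite: CaraianiNewton2023, proof of Cor. 6.1.1 p. 87] -/
theorem rung_of_thm61_of_lemma622Quartic (hA : CaraianiNewtonThm61) (hL : Lemma622QuarticCM) :
    QuarticCMEllipticGaloisToAutomorphic := by
  intro K _ _ hCM hd h5 E _ hnCM himg ℓ _ ι _ _
  refine of_weightZeroHecke ?_ ℓ ι
  obtain ⟨p, hp, h35, himgp, hDG⟩ := hL K hCM hd E hnCM himg
  haveI := hp
  exact hA K hCM h5 E hnCM p h35 hDG himgp

/-! ## 4. All degrees: `d = 0` and odd `d` are vacuous for CM fields -/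

/-- A CM field has even degree (`[K:ℚ] = [K⁺:ℚ]·[K:K⁺] = 2 [K⁺:ℚ]`). [folklore] -/
theorem even_finrank_of_isCMField (K : Type) [Field K] [NumberField K] (hK : NumberField.IsCMField K) :
    Even (Module.finrank ℚ K) := by
  haveI := hK
  rw [← Module.finrank_mul_finrank ℚ (NumberField.maximalRealSubfield K) K,
    Algebra.IsQuadraticExtension.finrank_eq_two (NumberField.maximalRealSubfield K) K]
  exact even_two.mul_left _

/-- The family is vacuous in degree `0` and in odd degrees. [folklore] -/
theorem family_of_not_even_or_zero (d : ℕ) (hd : ¬ Even d ∨ d = 0) : EllipticGaloisToAutomorphicCM d := by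
  intro K _ _ hCM hdeg
  exfalso
  rcases hd with hodd | rfl
  · exact hodd (hdeg ▸ even_finrank_of_isCMField K hCM)
  · exact absurd hdeg (Module.finrank_pos (R := ℚ) (M := K)).ne'

/-- **The higher cells** of the graded family: degrees `d ≥ 6` (open). -/
def HigherDegrees : Prop := ∀ d : ℕ, 6 ≤ d → EllipticGaloisToAutomorphicCM d

/-- **Every degree** from Thm. 6.1, the two cases of the quartic lemma and the higher cells (sorry-free assembly;
the floor `d = 2` via the tree's proved quadratic Lemma 6.2.2). -/
theorem family_of (hA : CaraianiNewtonThm61) (hG : Lemma622QuarticCMGalois) (hN : Lemma622QuarticCMNonGalois)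
    (hhigh : HigherDegrees) (d : ℕ) : EllipticGaloisToAutomorphicCM d := by
  have hL : Lemma622QuarticCM := lemma622Quartic_of_cases hG hN
  by_cases h6 : 6 ≤ d
  · exact hhigh d h6
  · interval_cases d
    · exact family_of_not_even_or_zero 0 (Or.inr rfl)
    · exact family_of_not_even_or_zero 1 (Or.inl (by decide))
    · exact floor_two (floorFact_of_thm61 hA)
    · exact family_of_not_even_or_zero 3 (Or.inl (by decide))
    · exact rung_of_thm61_of_lemma622Quartic hA hL
    · exact family_of_not_even_or_zero 5 (Or.inl (by decide))

/-! ## 5. The sector, its merge target and the off-sector complement -/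

/-- **The Caraiani–Newton sector of clause (B)**: `F` is imaginary CM with `ζ₅ ∉ F` and `ρ : Γ_F → GL_n(ℚ̄_ℓ)` has
every Frobenius characteristic polynomial of the framed dual Tate module of some NON-CM elliptic curve `E / F`
satisfying hypothesis (1) ∨ (2) of Cor. 6.1.1 (so `ρ` "is" `ρ_{E,ℓ}^∨`; no cast on `n` is needed since
`HasFrobCharpolyAt` takes any polynomial). -/
def InCNSector (F : Type) [Field F] [NumberField F] (ℓ : ℕ) [Fact ℓ.Prime] {n : ℕ}
    (ρ : FramedGaloisRep F (PadicAlgCl ℓ) n) : Prop :=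
  NumberField.IsCMField F ∧ (∀ x : F, x ^ 5 = 1 → x = 1) ∧
    ∃ (E : WeierstrassCurve F) (_ : E.IsElliptic), ¬ E.HasCM ∧
      (ModPImageAbsIrreducibleOverCyclotomic E 3 ∨
        @ModPImageAbsIrreducibleOverCyclotomic F _ E 5 ⟨Nat.prime_five⟩) ∧
      ∀ (v : HeightOneSpectrum (𝓞 F)) (P : Polynomial (PadicAlgCl ℓ)),
        (E.framedTateGaloisRepDual ℓ).HasFrobCharpolyAt v P → ρ.HasFrobCharpolyAt v P

/-- **Merge target**: clause (B) of E VERBATIM (cuspidal, L-algebraic, `Corresponds Rec ι π ρ` — a.e. Satake AND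
`LocalGlobalCompatibleAt` at every finite place) for EVERY reciprocity datum `Rec`, on the Caraiani–Newton sector. -/
def SectorGaloisToAutomorphic : Prop :=
  ∀ (F : Type) [Field F] [NumberField F] (Rec : ReciprocityData F) (n : ℕ), 0 < n →
    ∀ (hcpt : isCompact_glFiniteIntegralLevel n F) (ℓ : ℕ) [Fact ℓ.Prime] (ι : PadicAlgCl ℓ ≃+* ℂ)
      (ρ : FramedGaloisRep F (PadicAlgCl ℓ) n),
      ρ.toGaloisRep.IsIrreducible → IsGeometricFramed Rec ρ → InCNSector F ℓ ρ →
        ∃ π : CuspidalAutomorphicRepData n F hcpt, π.1.IsLAlgebraic ∧ Corresponds Rec ι π.1 ρ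

/-- **The off-sector complement**: E (`ReciprocityUpToIrreducibility`) with clause (A) entire and clause (B)
restricted to `ρ` NOT in the Caraiani–Newton sector. -/
def OffSectorReciprocity : Prop :=
  ∀ (F : Type) [Field F] [NumberField F], ∃ Rec : ReciprocityData F, ∀ n : ℕ, 0 < n →
    ∀ hcpt : isCompact_glFiniteIntegralLevel n F,
      (∀ π : CuspidalAutomorphicRepData n F hcpt, π.1.IsLAlgebraic →
        ∀ (ℓ : ℕ) [Fact ℓ.Prime] (ι : PadicAlgCl ℓ ≃+* ℂ),
          ∃ ρ : FramedGaloisRep F (PadicAlgCl ℓ) n, IsGeometricFramed Rec ρ ∧ Corresponds Rec ι π.1 ρ) ∧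
      (∀ (ℓ : ℕ) [Fact ℓ.Prime] (ι : PadicAlgCl ℓ ≃+* ℂ) (ρ : FramedGaloisRep F (PadicAlgCl ℓ) n),
        ρ.toGaloisRep.IsIrreducible → IsGeometricFramed Rec ρ → ¬ InCNSector F ℓ ρ →
          ∃ π : CuspidalAutomorphicRepData n F hcpt, π.1.IsLAlgebraic ∧ Corresponds Rec ι π.1 ρ)

/-! ## 6. The six registered stubs (no floor debt: the floor is `floorFact_of_thm61`) -/

/-- Caraiani–Newton 2023 Thm. 6.1 over every imaginary CM field `F ∌ ζ₅` — a theorem in print (no carrier).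
[cite: CaraianiNewton2023, Thm. 6.1 p. 87] -/
theorem stub_thm61 : CaraianiNewtonThm61 := by
  sorry

/-- **THE OPEN CORE, case A** (`F/ℚ` Galois): Lemma 6.2.2 for `E[p]` over Galois quartic CM fields — four-coordinate
version of the tree's proved quadratic argument.  Plausibly provable now (M/L). -/
theorem stub_lemma622QuarticGalois : Lemma622QuarticCMGalois := by
  sorry

/-- **THE OPEN CORE, case B** (`F/ℚ` not Galois): Lemma 6.2.2 for `E[p]` over non-Galois quartic CM fields.  OPEN;
the induced-from-`F̃(ζ_p)` locus is the risk. -/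
theorem stub_lemma622QuarticNonGalois : Lemma622QuarticCMNonGalois := by
  sorry

/-- The cells `d ≥ 6` of the family (open). -/
theorem stub_higherDegrees : HigherDegrees := by
  sorry

/-- Sector merge: from a.e.-Satake automorphy on the whole Caraiani–Newton sector (all degrees) to clause (B) of
E verbatim on the sector, for every `Rec` (multiplicity one / isobaric rigidity ⇒ the cuspidal `π`; L-algebraicity
from weight zero; local–global compatibility at every finite place, the `v ∣ ℓ` clause against the pinned Fontaine
datum — cf. Lemma 6.1.3 (3) of the source at `v ∤ p`). -/
theorem stub_sectorMerge : (∀ d : ℕ, EllipticGaloisToAutomorphicCM d) → SectorGaloisToAutomorphic := by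
  sorry

/-- The honest complement: E off the Caraiani–Newton sector. -/
theorem stub_offSector : OffSectorReciprocity := by
  sorry

/-! ## 7. Composition (no sorry below this line) -/

/-- **COMPOSITION — the crux BY NAME from the six stub statements.**  `Rec` and clause (A) come from the
off-sector statement; clause (B) is a case split on the Caraiani–Newton sector; the floor `d = 2` is Thm. 6.1 + the tree's
proved quadratic Lemma 6.2.2 (`floorFact_of_thm61`).  Conclusion spelled as the OrdinaryPrimeTransport copy of the shared decl
(same text); in the registered folder copy the item's IrreducibilityBySelfDuality decl is concluded BY NAME just below. -/
theorem ReciprocityUpToIrreducibility_of :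
    CaraianiNewtonThm61 → Lemma622QuarticCMGalois → Lemma622QuarticCMNonGalois → HigherDegrees →
    ((∀ d : ℕ, EllipticGaloisToAutomorphicCM d) → SectorGaloisToAutomorphic) →
    OffSectorReciprocity →
    Summit.Langlands.Langlands.Theses.OrdinaryPrimeTransport.ReciprocityUpToIrreducibility := by
  intro hA hG hN hhigh hmerge hoff F _ _
  obtain ⟨Rec, hall⟩ := hoff F
  refine ⟨Rec, fun n hn hcpt => ⟨(hall n hn hcpt).1, ?_⟩⟩
  intro ℓ _ ι ρ hirr hgeo
  by_cases hsec : InCNSector F ℓ ρ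
  · exact hmerge (family_of hA hG hN hhigh) F Rec n hn hcpt ℓ ι ρ hirr hgeo hsec
  · exact (hall n hn hcpt).2 ℓ ι ρ hirr hgeo hsec

/-- **THE REGISTERED SKELETON THEOREM** — the item's decl BY NAME from the six registered stubs (audit: proof-of-item
modulo the six sorries; the two route copies of the shared decl are the same term). -/
theorem reciprocityUpToIrreducibility_of_stubs :
    Summit.Langlands.Langlands.Theses.OrdinaryPrimeTransport.ReciprocityUpToIrreducibility :=
  ReciprocityUpToIrreducibility_of stub_thm61 stub_lemma622QuarticGalois stub_lemma622QuarticNonGalois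
    stub_higherDegrees stub_sectorMerge stub_offSector

/-! ## 8. The rung is a consequence of the top (sorry-free) -/

/-- `E → EllipticGaloisToAutomorphicCM d` for every `d` (clause (B) of E for its own `Rec`). -/
theorem ellipticGaloisToAutomorphicCM_of_top (d : ℕ)
    (hE : Summit.Langlands.Langlands.Theses.OrdinaryPrimeTransport.ReciprocityUpToIrreducibility) :
    EllipticGaloisToAutomorphicCM d := by
  intro K _ _ _hCM _hd _h5 E _ _hnCM _himg ℓ _ ι hirr hdR
  obtain ⟨Rec, hall⟩ := hE K
  have hcpt : isCompact_glFiniteIntegralLevel 2 K := isCompact_glFiniteIntegralLevel_holds 2 K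
  have hB : GaloisToAutomorphic 2 Rec hcpt := (hall 2 two_pos hcpt).2
  have hgeo : IsGeometricFramed Rec (E.framedTateGaloisRepDual ℓ) :=
    ⟨E.eventually_isUnramifiedAt_framedTateGaloisRepDual ℓ, fun v hv => hdR v hv⟩
  obtain ⟨π, -, hcorr⟩ := hB ℓ ι _ hirr hgeo
  refine ⟨hcpt, π, 1, ?_⟩
  filter_upwards [hcorr.1] with v hv
  exact hv

/-- `E → rung`. -/
theorem QuarticCMEllipticGaloisToAutomorphic_of_top
    (hE : Summit.Langlands.Langlands.Theses.OrdinaryPrimeTransport.ReciprocityUpToIrreducibility) :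
    QuarticCMEllipticGaloisToAutomorphic :=
  ellipticGaloisToAutomorphicCM_of_top 4 hE

end Summit.Langlands.Langlands.Cruxes.ReciprocityUpToIrreducibility.QuarticCMEllipticGaloisToAutomorphic

end
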